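import Summits.NavierStokesRegularity.NavierStokesRegularity.Theorems.AdaptedFrequencyFrequencyRigidityAxisymmetricCoreUnit
import Summits.NavierStokesRegularity.NavierStokesRegularity.Theorems.AdaptedFrequencyFrequencyRigidityFiniteABDilation
import Summits.NavierStokesRegularity.NavierStokesRegularity.Theorems.AdaptedFrequencyFrequencyRigidityViscosityNormalisation
import HarnessLib

/-!
# Crux `FrequencyRigidity` (stmt-NavierStokesRegularity-2955), line `scaled-energy-split`:
# the axisymmetric leaf of the finite child in Albritton–Barker form (Stub 2′)

Helper file (`--supports stmt-NavierStokesRegularity-2955`; theorems only, sorry-free).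

Stub 2′ of the line (`stub_finiteScaledEnergyLiouvilleAB`) forbids an inhabitant
`(ν, C, Λ₀, v, q, K)` of the crux body — a classical ancient Navier–Stokes flow `(v, q)` on
`ℝ³ × (−∞, 0)` with the global Type-I bound `‖v(t, x)‖ ≤ C/√(−t)`, an adapted
Gaussian-comparable kernel `K` at the pole, positive adapted enstrophy and constant adapted
frequency — lying in the Albritton–Barker class: SOME suitable pressure `ϖ`
(`IsSuitableWeakSolutionOn` on the open backward slab, Caffarelli–Kohn–Nirenberg 1982,
(2.1)–(2.5)) and weak spatial gradient `G'` with finite A–B quantity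
`𝐈(ℝ³ × ℝ₋; v, ϖ, G') < ∞` (`typeIBound (Iio 0 ×ˢ univ)`).  This file closes its AXISYMMETRIC
case (registered stubs `finiteAB_axisymmetricCore_unit`, `finiteAB_axisymmetricLeaf`), the
A–B-form twins of the classical-form theorems `stub_axisymmetricFlatCore_unit` /
`stub_finiteAxisymmetricLeaf` (pressure `q`, gradient `fderiv`).

* `finiteAB_axisymmetricCore_unit` (unit viscosity): a field `u` with a suitable pressure `ϖ` and
  a weak gradient `G` on the slab, `𝐈(u, ϖ, G) < ∞`, the Type-I rate `‖u(t, x)‖ ≤ C/√(−t)` and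
  axisymmetric slices is not backward-singular at the space–time origin.  This is the local
  theorem of Seregin–Šverák 2009 (Thm. 3.1 = Thm. 1.1; tree theorem
  `axisymmetricTypeIExclusion_of_tree`) read in the Albritton–Barker class, already assembled in
  the tree for the crux `RecurrentLiouville` as `rlAxisymRegular_of_repr` (representative
  `w = u`; the pressure is normalised to unit-ball mean zero, which leaves `𝐈` unchanged and puts
  `ϖ` in `L^{3/2}` of the Seregin–Šverák cylinder `Q = 𝒞 × ]−1, 0[ ⊆ Q((0,0), 2)`, and
  `u ∈ L³(Q)` by the `C`-term of `𝐈`); the pointwise rate gives `√(−t) ‖u‖ ≤ C` a.e. on `Q`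
  (`ae_sqrt_mul_norm_le_of_hasTypeITimeDecay`).  The smoothness hypothesis of the registered
  signature is not needed by the proof.
* `finiteAB_axisymmetricLeaf` (any viscosity `ν > 0`): a Stub-2′ witness with axisymmetric
  slices is impossible.  The pole is backward-singular for `v`
  (`isBackwardSingularPoint_of_witness`); the viscosity normalisation
  `u(s, y) = ν⁻¹ v(ν⁻¹ s, y)`, `π = ν⁻² ϖ(ν⁻¹ ·, ·)`, `G = ν⁻¹ G'(ν⁻¹ ·, ·)` keeps the A–B
  clause at viscosity `ν⁻¹ ν = 1` (`finiteAB_abClause_dilate` with `β = ν⁻¹`), is the velocity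
  of a classical unit-viscosity pair (`classical_viscosity`, whence joint smoothness), keeps the
  Type-I rate with constant `C/√ν` (`hasTypeITimeDecay_viscosity`), axisymmetry
  (`isAxisymmetric_viscosity`) and the backward-singular origin
  (`isBackwardSingularPoint_viscosity`) — contradicting the core.

## References

* G. Seregin, V. Šverák, *On Type I singularities of the local axi-symmetric solutions of the
  Navier–Stokes equations*, Comm. PDE 34 (2009), 171–201, Thm. 3.1 (= Thm. 1.1).
  [SereginSverak2009]
* D. Albritton, T. Barker, *On local Type I singularities of the Navier–Stokes equations and
  Liouville theorems*, J. Math. Fluid Mech. 21 (2019), Thm 1.1, §1 (the quantities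
  `A, C, D, E, 𝐈(ω)` and backward singular points), §3. [AlbrittonBarker2019]
* T. Tao, *Localisation and compactness properties of the Navier–Stokes global regularity
  problem*, Anal. PDE 6 (2013), footnote 3 (viscosity normalisation). [Tao2011]
-/

noncomputable section

-- the registered stub namespace repeats the summit name `NavierStokesRegularity` (summit = problem)
set_option linter.dupNamespace false

namespace Summit.NavierStokesRegularity.NavierStokesRegularity.Theorems

open Literature.Analysis.FluidPDE MeasureTheory Set Filter Function
open Summit.NavierStokesRegularity.NavierStokesRegularity.Theorems.FrequencyRigidity.ScaledEnergySplit

/-- **Stub `finiteAB_axisymmetricCore_unit` (axisymmetric unit-viscosity core of Stub 2′, line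
`scaled-energy-split`).**  Let `u` be jointly smooth on `(−∞, 0) × ℝ³`, let `(u, ϖ)` be a
suitable weak solution of the unforced unit-viscosity Navier–Stokes system on the open backward
slab with a weak spatial gradient `G`, the Type-I rate `‖u(t, x)‖ ≤ C/√(−t)`, axisymmetric slices
`u(t)`, `t < 0`, and finite Albritton–Barker quantity `𝐈(ℝ³ × ℝ₋; u, ϖ, G) < ∞`.  Then the
space–time origin is not a backward singular point of `u`: Seregin–Šverák 2009, Thm. 3.1 in the
Albritton–Barker class (`rlAxisymRegular_of_repr`, fed with the representative `w = u`, the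
slices' axisymmetry on `]−1, 0[` and the a.e. bound `√(−t) ‖u‖ ≤ C` on the Seregin–Šverák
cylinder). [cite: SereginSverak2009, Thm. 3.1 (= Thm. 1.1)] -/
theorem finiteAB_axisymmetricCore_unit : ∀ (C : ℝ) (u : ℝ → EuclideanSpace ℝ (Fin 3) → EuclideanSpace ℝ (Fin 3)) (ϖ : ℝ → EuclideanSpace ℝ (Fin 3) → ℝ) (G : ℝ → EuclideanSpace ℝ (Fin 3) → EuclideanSpace ℝ (Fin 3) →L[ℝ] EuclideanSpace ℝ (Fin 3)), Literature.Analysis.FluidPDE.IsSmoothSpaceTimeOn (Set.Iio 0) u → Literature.Analysis.FluidPDE.IsSuitableWeakSolutionOn (Literature.Analysis.FluidPDE.slab (EuclideanSpace ℝ (Fin 3)) (Set.Iio 0) isOpen_Iio) 1 0 u ϖ → Literature.Analysis.FluidPDE.HasWeakSpatialGradientOn (Literature.Analysis.FluidPDE.slab (EuclideanSpace ℝ (Fin 3)) (Set.Iio 0) isOpen_Iio) u G → Literature.Analysis.FluidPDE.HasTypeITimeDecay C u → (∀ t ∈ Set.Iio (0:ℝ), Literature.Analysis.FluidPDE.IsAxisymmetric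 (u t)) → Literature.Analysis.FluidPDE.typeIBound (Set.Iio (0:ℝ) ×ˢ Set.univ) u ϖ G < ⊤ → ¬ Literature.Analysis.FluidPDE.IsBackwardSingularPoint u 0 := by
  intro C u ϖ G _ hsw hwg hdec haxi hI
  exact rlAxisymRegular_of_repr hsw hwg hI (w := u) (Eventually.of_forall fun _ => rfl)
    (fun t ht => haxi t ht.2) ⟨C, ae_sqrt_mul_norm_le_of_hasTypeITimeDecay hdec⟩

/-- **Stub `finiteAB_axisymmetricLeaf` (the axisymmetric case of Stub 2′ is CLOSED, line
`scaled-energy-split`).**  No `(ν, C, Λ₀, v, q, K)` in the crux body that lies in the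
Albritton–Barker class (some suitable pressure `ϖ` and weak gradient `G'` on the backward slab with
`𝐈(v, ϖ, G') < ∞`) has axisymmetric velocity slices: the pole is backward-singular
(`isBackwardSingularPoint_of_witness`), the viscosity normalisation `β = ν⁻¹` of the A–B clause
(`finiteAB_abClause_dilate`) is a unit-viscosity package with smooth velocity
(`classical_viscosity`), Type-I constant `C/√ν` (`hasTypeITimeDecay_viscosity`), axisymmetric
slices (`isAxisymmetric_viscosity`) and a backward-singular origin
(`isBackwardSingularPoint_viscosity`), which the core `finiteAB_axisymmetricCore_unit` forbids.
[cite: SereginSverak2009, Thm. 3.1 (= Thm. 1.1)] -/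
theorem finiteAB_axisymmetricLeaf : ∀ (ν C Λ₀ : ℝ) (v : ℝ → EuclideanSpace ℝ (Fin 3) → EuclideanSpace ℝ (Fin 3)) (q : ℝ → EuclideanSpace ℝ (Fin 3) → ℝ) (K : ℝ → EuclideanSpace ℝ (Fin 3) → ℝ), (0 < ν ∧ Literature.Analysis.FluidPDE.IsClassicalNSSolutionOn (Set.Iio 0) ν 0 v q ∧ (∀ t ∈ Set.Iio (0:ℝ), ∀ x, ‖v t x‖ ≤ C / Real.sqrt (-t)) ∧ ContDiffOn ℝ 2 (Function.uncurry K) (Set.Iio (0:ℝ) ×ˢ Set.univ) ∧ (∀ t ∈ Set.Iio (0:ℝ), ∀ x, 0 < K t x) ∧ (∀ t ∈ Set.Iio (0:ℝ), ∀ x, Literature.Analysis.FluidPDE.timeDerivWithin (Set.Iio (0:ℝ)) K t x + fderiv ℝ (K t) x (v t x) + ν * Laplacian.laplacian (K t) x = 0) ∧ (∀ t ∈ Set.Iio (0:ℝ), ∫ x, K t x = 1) ∧ (∀ φ : EuclideanSpace ℝ (Fin 3) → ℝ, Continuous φ → (∃ M : ℝ, ∀ x, |φ x| ≤ M) → Filter.Tendsto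 (fun t => ∫ x, φ x * K t x) (nhdsWithin (0:ℝ) (Set.Iio (0:ℝ))) (nhds (φ (0 : EuclideanSpace ℝ (Fin 3))))) ∧ (∃ c₁ c₂ C₁ C₂ : ℝ, 0 < c₁ ∧ 0 < c₂ ∧ 0 < C₁ ∧ 0 < C₂ ∧ ∀ t ∈ Set.Iio (0:ℝ), ∀ x, c₁ * ((0:ℝ) - t) ^ (-(3:ℝ) / 2) * Real.exp (-(‖x - (0 : EuclideanSpace ℝ (Fin 3))‖ ^ 2) / (c₂ * ((0:ℝ) - t))) ≤ K t x ∧ K t x ≤ C₁ * ((0:ℝ) - t) ^ (-(3:ℝ) / 2) * Real.exp (-(‖x - (0 : EuclideanSpace ℝ (Fin 3))‖ ^ 2) / (C₂ * ((0:ℝ) - t)))) ∧ (∀ H Λ : ℝ → ℝ, H = (fun t => ∫ x, ‖Literature.Analysis.FluidPDE.curl (v t) x‖ ^ 2 * K t x) → Λ = (fun t => (0 - t) * deriv H t / H t) → (∀ t ∈ Set.Iio (0:ℝ), 0 < H t) ∧ (∀ t ∈ Set.Iio (0:ℝ), Λ t = Λ₀))) → (∃ (ϖ : ℝ → EuclideanSpace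 ℝ (Fin 3) → ℝ) (G' : ℝ → EuclideanSpace ℝ (Fin 3) → EuclideanSpace ℝ (Fin 3) →L[ℝ] EuclideanSpace ℝ (Fin 3)), Literature.Analysis.FluidPDE.IsSuitableWeakSolutionOn (Literature.Analysis.FluidPDE.slab (EuclideanSpace ℝ (Fin 3)) (Set.Iio 0) isOpen_Iio) ν 0 v ϖ ∧ Literature.Analysis.FluidPDE.HasWeakSpatialGradientOn (Literature.Analysis.FluidPDE.slab (EuclideanSpace ℝ (Fin 3)) (Set.Iio 0) isOpen_Iio) v G' ∧ Literature.Analysis.FluidPDE.typeIBound (Set.Iio (0:ℝ) ×ˢ Set.univ) v ϖ G' < ⊤) → (∀ t ∈ Set.Iio (0:ℝ), Literature.Analysis.FluidPDE.IsAxisymmetric (v t)) → False := by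
  intro ν C Λ₀ v q K hbody hAB haxi
  obtain ⟨ϖ, G', hsw, hwg, hI⟩ := hAB
  obtain ⟨hν, hNS, hTI, hKc, hCmp, hF⟩ := (body_iff_bundles ν C Λ₀ v q K).1 hbody
  -- (a) the pole is backward-singular for `v`
  have hsing : IsBackwardSingularPoint v 0 :=
    isBackwardSingularPoint_of_witness hν hNS hTI hKc hCmp hF
  -- (b) normalise the viscosity: `β = ν⁻¹` in the A–B dilation clause
  obtain ⟨hsw1, hwg1, hI1⟩ := finiteAB_abClause_dilate ν ν⁻¹ hν (inv_pos.2 hν) v ϖ G' hsw hwg hI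
  rw [inv_mul_cancel₀ hν.ne'] at hsw1
  -- (c) smoothness, Type-I rate `C/√ν`, axisymmetry and the singular origin survive; the core
  -- forbids the normalised package
  exact finiteAB_axisymmetricCore_unit (C / Real.sqrt ν) _ _ _
    (classical_viscosity hν hNS).smooth_velocity hsw1 hwg1 (hasTypeITimeDecay_viscosity hν hTI)
    (isAxisymmetric_viscosity haxi hν) hI1 (isBackwardSingularPoint_viscosity hν hsing)

end Summit.NavierStokesRegularity.NavierStokesRegularity.Theorems

end
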